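import Summits.NavierStokesRegularity.FluidComputer.ClayBlowupLocalGigaMiura
import HarnessLib

/-!
# LOCAL GIGA–MIURA WITH THE CLAY FORCE, EVERY VISCOSITY: near EVERY Type I singular point of a Clay
# blow-up the vorticity directions are NOT continuously aligned

Cell `ns-blowup`, seat `ns-blowup-ecbridge-2` (g11; the E–C endpoint theory seat). LABEL: E–C typing
(KERNEL — no named fact, no new definition). WHAT THIS IS NOT: not Navier–Stokes evidence — a
necessary condition on the TYPE `ClayBlowup ν` with its Clay force; no inhabitant is claimed.
Companion memo: `run/shared/lean/pub/ns-blowup/ecbridge2/ECBRIDGE-2-MEMO-10.md`.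

## Content

`ClayBlowupLocalGigaMiura.lean` proves the LOCAL Giga–Miura theorem at viscosity `1`
(`not_localAlignment_of_localTypeI_one`). This file transports it to every `ν > 0` through the
viscosity normalisation `ClayBlowup.rescale` (a pure time dilation: balls in space are unchanged) and
states the headline corollaries.

* §1 `isBackwardBoundedAt_of_rescale`, `eventually_localTypeI_rescale`,
  `localScaledAlignment_rescale` — backward boundedness, the LOCAL Type I bound and the LOCAL (CA′)
  through `rescale`.
* §2 `ClayBlowup.not_localAlignment_of_localTypeI` (every `μ > 0`);
  **`ClayBlowup.not_local_continuousAlignment_of_localTypeI_forced`** — at EVERY point `x₁` which is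
  not backward bounded and in EVERY ball `B(x₁, r₀)` on which a Type I bound holds near `T`: for every
  threshold `d > 0` and modulus `η` there are a time `t ∈ (0, T)` and two points OF THAT BALL with
  vorticities above `d` whose directions differ by MORE than `η(‖x − x'‖)`;
  **`ClayBlowup.not_localTypeI_of_local_continuousAlignment_forced`** — a singular point near which
  the directions are continuously aligned is NOT a (locally) Type I point; `DesignedBlowup` twins.
  g10's global `not_scaledAlignment_of_typeI` is the special case at any singular point (singular
  points exist: `exists_not_isBackwardBoundedAt`); it is not restated.

References: Y. Giga, H. Miura, Comm. Math. Phys. 303 (2011), Thm 1.1, Rem. 1.4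
[cite: GigaMiura2011, Thm 1.1 and Rem. 1.4]; Koch–Nadirashvili–Seregin–Šverák, Acta Math. 203
(2009), Prop 6.1 [cite: KochNadirashviliSereginSverak2009, Prop 6.1]; C. L. Fefferman, (C)
[cite: FeffermanClay2006, (C)].
-/

noncomputable section

namespace Summit.NavierStokesRegularity.FluidComputer

open Set MeasureTheory Filter Topology Function Metric
open scoped ENNReal NNReal
open Literature.Analysis Literature.Analysis.FluidPDE
open Summit.NavierStokesRegularity.NavierStokesRegularity

namespace ClayBlowup

variable {μ ν : ℝ} (X : ClayBlowup μ)

/-! ## §1 Transport through the viscosity normalisation -/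

/-- **Backward boundedness descends through the viscosity normalisation**: if the rescaled blow-up
`a u(a t, x)` (`a = ν/μ`, lifespan `T/a`) is backward bounded at `(T/a, x₀)` then `u` is backward
bounded at `(T, x₀)` (radius `min ρ (√a ρ)`, bound `a⁻¹ B`). [folklore] -/
theorem isBackwardBoundedAt_of_rescale (hμ : 0 < μ) (hν : 0 < ν) {x₀ : EuclideanSpace ℝ (Fin 3)}
    (h : IsBackwardBoundedAt (X.rescale hμ hν).u (X.rescale hμ hν).T x₀) :
    IsBackwardBoundedAt X.u X.T x₀ := by
  set a : ℝ := ν / μ with ha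
  have ha0 : 0 < a := div_pos hν hμ
  have hYT : (X.rescale hμ hν).T = X.T / a := X.rescale_T hμ hν
  have hYu : ∀ s y, (X.rescale hμ hν).u s y = a • X.u (a * s) y := fun s y =>
    X.rescale_u_apply hμ hν s y
  obtain ⟨ρ, hρ, B, hB⟩ := h
  obtain ⟨ρ', hρ'0, hρ'ρ, hρ'a⟩ : ∃ ρ' : ℝ, 0 < ρ' ∧ ρ' ≤ ρ ∧ ρ' ^ 2 ≤ a * ρ ^ 2 := by
    refine ⟨min ρ (Real.sqrt a * ρ), lt_min hρ (by positivity), min_le_left _ _, ?_⟩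
    calc min ρ (Real.sqrt a * ρ) ^ 2 ≤ (Real.sqrt a * ρ) ^ 2 :=
          pow_le_pow_left₀ (le_min hρ.le (by positivity)) (min_le_right _ _) 2
      _ = a * ρ ^ 2 := by rw [mul_pow, Real.sq_sqrt ha0.le]
  refine ⟨ρ', hρ'0, a⁻¹ * B, fun t ht x hx => ?_⟩
  have hts : t / a ∈ Ioo ((X.rescale hμ hν).T - ρ ^ 2) (X.rescale hμ hν).T := by
    rw [hYT]
    constructor
    · rw [lt_div_iff₀ ha0, sub_mul, div_mul_cancel₀ _ ha0.ne']
      nlinarith [ht.1]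
    · exact div_lt_div_of_pos_right ht.2 ha0
  have h1 := hB (t / a) hts x (ball_subset_ball hρ'ρ hx)
  rw [hYu, mul_div_cancel₀ _ ha0.ne', norm_smul, Real.norm_of_nonneg ha0.le] at h1
  calc ‖X.u t x‖ = a⁻¹ * (a * ‖X.u t x‖) := by field_simp
    _ ≤ a⁻¹ * B := mul_le_mul_of_nonneg_left h1 (inv_pos.2 ha0).le

/-- **The LOCAL Type I bound is invariant under the viscosity normalisation**: if
`‖u(t, x)‖ ≤ C/√(T − t)` near `T` for `x ∈ B(x₁, r₀)` then `a u(a t, x)` obeys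
`‖·‖ ≤ (a/√a) C/√(T/a − s)` near `T/a` on the same ball. [cite: GigaMiura2011, §1 (Type I)] -/
theorem eventually_localTypeI_rescale (hμ : 0 < μ) (hν : 0 < ν) {x₁ : EuclideanSpace ℝ (Fin 3)}
    {r₀ C : ℝ} (hC : ∀ᶠ t in 𝓝[<] X.T, ∀ x ∈ ball x₁ r₀, ‖X.u t x‖ ≤ C / Real.sqrt (X.T - t)) :
    ∀ᶠ s in 𝓝[<] (X.rescale hμ hν).T, ∀ x ∈ ball x₁ r₀,
      ‖(X.rescale hμ hν).u s x‖ ≤ (ν / μ) / Real.sqrt (ν / μ) * C /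
        Real.sqrt ((X.rescale hμ hν).T - s) := by
  set a : ℝ := ν / μ with ha
  have ha0 : 0 < a := div_pos hν hμ
  rw [X.rescale_T hμ hν]
  filter_upwards [(tendsto_mul_left_nhdsLT (T := X.T) ha0).eventually hC, self_mem_nhdsWithin]
    with s hs hsT y hy
  rw [X.rescale_u_apply hμ hν, norm_smul, Real.norm_of_nonneg ha0.le]
  have hlt : s < X.T / a := hsT
  have hpos : 0 < X.T / a - s := sub_pos.2 hlt
  have e1 : X.T - a * s = a * (X.T / a - s) := by field_simp
  have h1 := hs y hy
  rw [e1, Real.sqrt_mul ha0.le] at h1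
  have hsa : 0 < Real.sqrt a := Real.sqrt_pos.2 ha0
  have hsD : 0 < Real.sqrt (X.T / a - s) := Real.sqrt_pos.2 hpos
  calc a * ‖X.u (a * s) y‖ ≤ a * (C / (Real.sqrt a * Real.sqrt (X.T / a - s))) :=
        mul_le_mul_of_nonneg_left h1 ha0.le
    _ = a / Real.sqrt a * C / Real.sqrt (X.T / a - s) := by
        field_simp

/-- **The LOCAL (CA′) is invariant under the viscosity normalisation**: the vorticity of
`a u(a t, ·)` is `a curl u(a t, ·)`, with the SAME direction field; the threshold becomes `a d`, the
rate `θ(a s)`, and `μ(T − a s) = ν(T/a − s)` for `a = ν/μ`; the ball `B(x₁, r₀)` is unchanged.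
[cite: GigaMiura2011, Rem. 1.4] -/
theorem localScaledAlignment_rescale (hμ : 0 < μ) (hν : 0 < ν) {x₁ : EuclideanSpace ℝ (Fin 3)}
    {r₀ : ℝ}
    (hCA : ∃ d : ℝ, 0 < d ∧ ∃ η θ : ℝ → ℝ, MonotoneOn η (Ici 0) ∧ ContinuousOn η (Ici 0) ∧
      η 0 = 0 ∧ (∀ t, 0 ≤ θ t) ∧ Tendsto θ (𝓝[<] X.T) (𝓝 0) ∧
      ∀ t ∈ Ioo 0 X.T, ∀ x ∈ ball x₁ r₀, ∀ x' ∈ ball x₁ r₀,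
        d < ‖curl (X.u t) x‖ → d < ‖curl (X.u t) x'‖ →
          ‖vorticityDirection (curl (X.u t)) x - vorticityDirection (curl (X.u t)) x'‖ ≤
            η (θ t * ‖x - x'‖ / Real.sqrt (μ * (X.T - t)))) :
    ∃ d : ℝ, 0 < d ∧ ∃ η θ : ℝ → ℝ, MonotoneOn η (Ici 0) ∧ ContinuousOn η (Ici 0) ∧
      η 0 = 0 ∧ (∀ t, 0 ≤ θ t) ∧ Tendsto θ (𝓝[<] (X.rescale hμ hν).T) (𝓝 0) ∧
      ∀ t ∈ Ioo 0 (X.rescale hμ hν).T, ∀ x ∈ ball x₁ r₀, ∀ x' ∈ ball x₁ r₀,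
        d < ‖curl ((X.rescale hμ hν).u t) x‖ → d < ‖curl ((X.rescale hμ hν).u t) x'‖ →
          ‖vorticityDirection (curl ((X.rescale hμ hν).u t)) x -
              vorticityDirection (curl ((X.rescale hμ hν).u t)) x'‖ ≤
            η (θ t * ‖x - x'‖ / Real.sqrt (ν * ((X.rescale hμ hν).T - t))) := by
  obtain ⟨d, hd, η, θ, hηm, hηc, hη0, hθ0, hθ, hal⟩ := hCA
  set a : ℝ := ν / μ with ha
  have ha0 : 0 < a := div_pos hν hμ
  have haμ : μ * a = ν := by rw [ha]; field_simp
  have hT' : (X.rescale hμ hν).T = X.T / a := X.rescale_T hμ hν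
  have hslice : ∀ s, (X.rescale hμ hν).u s = fun y => a • X.u (a * s) y := fun s =>
    funext fun y => X.rescale_u_apply hμ hν s y
  have hmaps : ∀ s ∈ Ioo 0 (X.T / a), a * s ∈ Ioo 0 X.T := fun s hs =>
    ⟨mul_pos ha0 hs.1, by
      have := mul_lt_mul_of_pos_left hs.2 ha0; rwa [mul_div_cancel₀ _ ha0.ne'] at this⟩
  have hcurl : ∀ s ∈ Ioo 0 (X.T / a), ∀ y,
      curl ((X.rescale hμ hν).u s) y = a • curl (X.u (a * s)) y := by
    intro s hs y
    rw [hslice]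
    have hdiff : DifferentiableAt ℝ (X.u (a * s)) y :=
      ((X.classical.contDiff_velocity ⟨(hmaps s hs).1.le, (hmaps s hs).2⟩).differentiable
        (by norm_cast)) y
    exact curl_const_smul hdiff a
  have hdirn : ∀ s ∈ Ioo 0 (X.T / a), ∀ y,
      vorticityDirection (curl ((X.rescale hμ hν).u s)) y =
        vorticityDirection (curl (X.u (a * s))) y := by
    intro s hs y
    have e : curl ((X.rescale hμ hν).u s) = fun y => a • curl (X.u (a * s)) (id y) :=
      funext (hcurl s hs)
    rw [e]
    exact vorticityDirection_const_smul_comp ha0 _ id y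
  refine ⟨a * d, mul_pos ha0 hd, η, fun s => θ (a * s), hηm, hηc, hη0, fun s => hθ0 _, ?_, ?_⟩
  · rw [hT']
    exact hθ.comp (tendsto_mul_left_nhdsLT ha0)
  · intro s hs y hy y' hy' hdy hdy'
    rw [hT'] at hs
    rw [hcurl s hs, norm_smul, Real.norm_of_nonneg ha0.le] at hdy hdy'
    have hy1 : d < ‖curl (X.u (a * s)) y‖ := lt_of_mul_lt_mul_left hdy ha0.le
    have hy1' : d < ‖curl (X.u (a * s)) y'‖ := lt_of_mul_lt_mul_left hdy' ha0.le
    rw [hdirn s hs, hdirn s hs]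
    have key := hal (a * s) (hmaps s hs) y hy y' hy' hy1 hy1'
    have e : μ * (X.T - a * s) = ν * ((X.rescale hμ hν).T - s) := by
      rw [hT', ← haμ]; field_simp
    rwa [e] at key

/-! ## §2 Local Giga–Miura with the Clay force, every viscosity -/

/-- **LOCAL GIGA–MIURA WITH THE CLAY FORCE** (`μ > 0`, ANY Clay force; no named fact): at a point
`x₁` which is not backward bounded, a LOCAL Type I bound on `B(x₁, r₀)` near `T` and the LOCAL scaled
continuous alignment (CA′) on `{|ω| > d} ∩ B(x₁, r₀)` are incompatible (normalise the viscosity and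
apply `not_localAlignment_of_localTypeI_one`). [cite: GigaMiura2011, Thm 1.1 and Rem. 1.4] -/
theorem not_localAlignment_of_localTypeI (hμ : 0 < μ) {x₁ : EuclideanSpace ℝ (Fin 3)}
    (hx₁ : ¬ IsBackwardBoundedAt X.u X.T x₁) {r₀ : ℝ} (hr₀ : 0 < r₀)
    (hI : ∃ C : ℝ, ∀ᶠ t in 𝓝[<] X.T, ∀ x ∈ ball x₁ r₀, ‖X.u t x‖ ≤ C / Real.sqrt (X.T - t))
    (hCA : ∃ d : ℝ, 0 < d ∧ ∃ η θ : ℝ → ℝ, MonotoneOn η (Ici 0) ∧ ContinuousOn η (Ici 0) ∧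
      η 0 = 0 ∧ (∀ t, 0 ≤ θ t) ∧ Tendsto θ (𝓝[<] X.T) (𝓝 0) ∧
      ∀ t ∈ Ioo 0 X.T, ∀ x ∈ ball x₁ r₀, ∀ x' ∈ ball x₁ r₀,
        d < ‖curl (X.u t) x‖ → d < ‖curl (X.u t) x'‖ →
          ‖vorticityDirection (curl (X.u t)) x - vorticityDirection (curl (X.u t)) x'‖ ≤
            η (θ t * ‖x - x'‖ / Real.sqrt (μ * (X.T - t)))) : False := by
  obtain ⟨C, hC⟩ := hI
  exact (X.rescale hμ one_pos).not_localAlignment_of_localTypeI_one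
    (fun h => hx₁ (X.isBackwardBoundedAt_of_rescale hμ one_pos h)) hr₀
    ⟨_, X.eventually_localTypeI_rescale hμ one_pos hC⟩
    (X.localScaledAlignment_rescale hμ one_pos hCA)

/-- **NEAR EVERY TYPE I SINGULAR POINT OF A CLAY BLOW-UP — WITH ITS CLAY FORCE — THE VORTICITY
DIRECTIONS ARE NOT CONTINUOUSLY ALIGNED** (`μ > 0`; no named fact): if `x₁` is not backward bounded
at `T` and `‖u(t, x)‖ ≤ C/√(T − t)` for `t` near `T` and `x ∈ B(x₁, r₀)`, then for every vorticity
threshold `d > 0` and every modulus of continuity `η` (monotone and continuous on `[0, ∞)`,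
`η(0) = 0`) there are a time `t ∈ (0, T)` and two points OF `B(x₁, r₀)` of vorticity magnitude `> d`
whose directions differ by MORE than `η(‖x − x'‖)`. Localises g10's
`not_continuousAlignment_of_typeI_forced` to any one singular point and any ball around it.
[cite: GigaMiura2011, Thm 1.1] -/
theorem not_local_continuousAlignment_of_localTypeI_forced (hμ : 0 < μ)
    {x₁ : EuclideanSpace ℝ (Fin 3)} (hx₁ : ¬ IsBackwardBoundedAt X.u X.T x₁) {r₀ : ℝ} (hr₀ : 0 < r₀)
    (hI : ∃ C : ℝ, ∀ᶠ t in 𝓝[<] X.T, ∀ x ∈ ball x₁ r₀, ‖X.u t x‖ ≤ C / Real.sqrt (X.T - t))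
    {d : ℝ} (hd : 0 < d) {η : ℝ → ℝ} (hηm : MonotoneOn η (Ici 0)) (hηc : ContinuousOn η (Ici 0))
    (hη0 : η 0 = 0) :
    ∃ t ∈ Ioo 0 X.T, ∃ x ∈ ball x₁ r₀, ∃ x' ∈ ball x₁ r₀,
      d < ‖curl (X.u t) x‖ ∧ d < ‖curl (X.u t) x'‖ ∧
        η ‖x - x'‖ <
          ‖vorticityDirection (curl (X.u t)) x - vorticityDirection (curl (X.u t)) x'‖ := by
  by_contra hcon
  push Not at hcon
  refine X.not_localAlignment_of_localTypeI hμ hx₁ hr₀ hI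
    ⟨d, hd, η, fun t => Real.sqrt (μ * (X.T - t)), hηm, hηc, hη0, fun t => Real.sqrt_nonneg _,
      ?_, fun t ht x hx x' hx' hdx hdx' => ?_⟩
  · -- `√(μ(T − t)) → 0` as `t ↑ T`
    have h1 : Tendsto (fun t : ℝ => μ * (X.T - t)) (𝓝[<] X.T) (𝓝 0) := by
      have : Tendsto (fun t : ℝ => μ * (X.T - t)) (𝓝 X.T) (𝓝 (μ * (X.T - X.T))) :=
        (continuous_const.mul (continuous_const.sub continuous_id)).tendsto X.T
      rw [sub_self, mul_zero] at this
      exact this.mono_left nhdsWithin_le_nhds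
    have h2 := (Real.continuous_sqrt.tendsto 0).comp h1
    rwa [Real.sqrt_zero] at h2
  · have hpos : 0 < Real.sqrt (μ * (X.T - t)) := Real.sqrt_pos.2 (mul_pos hμ (by linarith [ht.2]))
    rw [mul_div_cancel_left₀ _ hpos.ne']
    exact hcon t ht x hx x' hx' hdx hdx'

/-- **A SINGULAR POINT NEAR WHICH THE VORTICITY DIRECTIONS ARE CONTINUOUSLY ALIGNED IS NOT A TYPE I
POINT, WITH THE CLAY FORCE** (`μ > 0`): if for some `d > 0` and modulus `η` the directions satisfy
`‖ξ(t,x) − ξ(t,x')‖ ≤ η(‖x − x'‖)` for `x, x' ∈ B(x₁, r₀) ∩ {|ω(t,·)| > d}` and all `t ∈ (0, T)`,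
then NO bound `‖u(t, x)‖ ≤ C/√(T − t)` holds near `T` on `B(x₁, r₀)`. Localises g10's
`not_typeI_of_continuousAlignment_forced`. [cite: GigaMiura2011, Thm 1.1] -/
theorem not_localTypeI_of_local_continuousAlignment_forced (hμ : 0 < μ)
    {x₁ : EuclideanSpace ℝ (Fin 3)} (hx₁ : ¬ IsBackwardBoundedAt X.u X.T x₁) {r₀ : ℝ} (hr₀ : 0 < r₀)
    {d : ℝ} (hd : 0 < d) {η : ℝ → ℝ} (hηm : MonotoneOn η (Ici 0)) (hηc : ContinuousOn η (Ici 0))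
    (hη0 : η 0 = 0)
    (hCA : ∀ t ∈ Ioo 0 X.T, ∀ x ∈ ball x₁ r₀, ∀ x' ∈ ball x₁ r₀,
      d < ‖curl (X.u t) x‖ → d < ‖curl (X.u t) x'‖ →
        ‖vorticityDirection (curl (X.u t)) x - vorticityDirection (curl (X.u t)) x'‖ ≤
          η ‖x - x'‖) (C : ℝ) :
    ¬ ∀ᶠ t in 𝓝[<] X.T, ∀ x ∈ ball x₁ r₀, ‖X.u t x‖ ≤ C / Real.sqrt (X.T - t) := by
  intro hI
  obtain ⟨t, ht, x, hx, x', hx', hdx, hdx', hlt⟩ :=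
    X.not_local_continuousAlignment_of_localTypeI_forced hμ hx₁ hr₀ ⟨C, hI⟩ hd hηm hηc hη0
  exact absurd (hCA t ht x hx x' hx' hdx hdx') (not_le.2 hlt)

-- g10's global `not_scaledAlignment_of_typeI` is the special case of
-- `not_localAlignment_of_localTypeI` at any point of `exists_not_isBackwardBoundedAt` (no restatement).

end ClayBlowup

/-! ## §3 `DesignedBlowup` twins -/

namespace DesignedBlowup

variable {ν : ℝ} (D : DesignedBlowup ν)

/-- **Local Giga–Miura WITH the force, for designed blow-ups**: near every Type I singular point
the vorticity directions are not continuously aligned. [cite: GigaMiura2011, Thm 1.1] -/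
theorem not_local_continuousAlignment_of_localTypeI_forced (hν : 0 < ν)
    {x₁ : EuclideanSpace ℝ (Fin 3)} (hx₁ : ¬ IsBackwardBoundedAt D.u D.T x₁) {r₀ : ℝ} (hr₀ : 0 < r₀)
    (hI : ∃ C : ℝ, ∀ᶠ t in 𝓝[<] D.T, ∀ x ∈ ball x₁ r₀, ‖D.u t x‖ ≤ C / Real.sqrt (D.T - t))
    {d : ℝ} (hd : 0 < d) {η : ℝ → ℝ} (hηm : MonotoneOn η (Ici 0)) (hηc : ContinuousOn η (Ici 0))
    (hη0 : η 0 = 0) :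
    ∃ t ∈ Ioo 0 D.T, ∃ x ∈ ball x₁ r₀, ∃ x' ∈ ball x₁ r₀,
      d < ‖curl (D.u t) x‖ ∧ d < ‖curl (D.u t) x'‖ ∧
        η ‖x - x'‖ <
          ‖vorticityDirection (curl (D.u t)) x - vorticityDirection (curl (D.u t)) x'‖ :=
  D.toClayBlowup.not_local_continuousAlignment_of_localTypeI_forced hν hx₁ hr₀ hI hd hηm hηc hη0

/-- **A continuously aligned singular point of a designed blow-up is not a Type I point, WITH its
force.** [cite: GigaMiura2011, Thm 1.1] -/
theorem not_localTypeI_of_local_continuousAlignment_forced (hν : 0 < ν)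
    {x₁ : EuclideanSpace ℝ (Fin 3)} (hx₁ : ¬ IsBackwardBoundedAt D.u D.T x₁) {r₀ : ℝ} (hr₀ : 0 < r₀)
    {d : ℝ} (hd : 0 < d) {η : ℝ → ℝ} (hηm : MonotoneOn η (Ici 0)) (hηc : ContinuousOn η (Ici 0))
    (hη0 : η 0 = 0)
    (hCA : ∀ t ∈ Ioo 0 D.T, ∀ x ∈ ball x₁ r₀, ∀ x' ∈ ball x₁ r₀,
      d < ‖curl (D.u t) x‖ → d < ‖curl (D.u t) x'‖ →
        ‖vorticityDirection (curl (D.u t)) x - vorticityDirection (curl (D.u t)) x'‖ ≤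
          η ‖x - x'‖) (C : ℝ) :
    ¬ ∀ᶠ t in 𝓝[<] D.T, ∀ x ∈ ball x₁ r₀, ‖D.u t x‖ ≤ C / Real.sqrt (D.T - t) :=
  D.toClayBlowup.not_localTypeI_of_local_continuousAlignment_forced hν hx₁ hr₀ hd hηm hηc hη0 hCA C

end DesignedBlowup

end Summit.NavierStokesRegularity.FluidComputer

end
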